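import Literature.AnabelianGeometry.AbsoluteAnabelian.AbsTopI.ChainTransportThm
import Literature.AnabelianGeometry.AbsoluteAnabelian.SlimTransport
import Literature.AnabelianGeometry.SemiGraphs.WitnessIwahoriGroup
import HarnessLib

/-!
# [AbsTopI] Def 4.2 (iii) / Thm 4.7 (i), (iii): the FACT-LIST schema rows F-0198, F-0200, F-0202 —
# instance forms PROVED, universal closures REFUTED

S. Mochizuki, *Topics in Absolute Anabelian Geometry I: Generalities*, J. Math. Sci. Univ. Tokyo 19
(2012) [MochizukiAbsTopI2012], Def 4.2 (iii)–(iv) pp. 49–50, Thm 4.7 (i)–(iii) p. 57 (manuscript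
pagination, lit key `paper:url-11ac98ba15fc`).

PROOF-ONLY companion of `AbsTopI/SemiAbsoluteChains.lean` (abc-iut cell, block F fact-proving wave,
seat abc-iut-f-058, tranche 58 of `plan/F-TRANCHES.tsv`; FACT-LIST rows **F-0198**
`AbsTopI.CuspidalDataCompat`, **F-0200** `AbsTopI.SchemeChains.Thm_4_7_i`, **F-0202**
`AbsTopI.SchemeChains.Thm_4_7_iii`, all `kernel_closedness = parametrised`).  No definition, no
instance; nothing of the trunk file is restated or edited.

The three rows are PREDICATES, not closed statements:

* `CuspidalDataCompat φ C₁ C₂` (Def 4.2 (iii) (3_Π) "cuspidal decomposition groups, given up to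
  conjugacy") is the HYPOTHESIS of the proved Thm 4.7 (ii) (`thm_4_7_ii_holds`, `ChainTransportThm`):
  "the cuspidal data `C₁` on `Π_E` and `C₂` on `Π_F` correspond under `φ : E ≅ F`".  Its universal
  closure is FALSE at every extension (`exists_not_cuspidalDataCompat`: no cusps vs one cusp with
  `D = Π`; `not_forall_cuspidalDataCompat`), while the INSTANCE FORMS in which the hypothesis is used
  are PROVED here: reflexivity (`CuspidalDataCompat.refl`, the case `φ = id` giving the category
  `Chain(Π)` itself), transitivity (`CuspidalDataCompat.trans`; symmetry is `CuspidalDataCompat.symm`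
  of `ChainTransportCusp`), and TRANSPORT: along every isomorphism of extensions `φ` every cuspidal
  datum `C₁` has a compatible partner `C₂ := φ(C₁)` (`exists_cuspidalDataCompat`), so that Thm 4.7
  (ii) applies to every `φ` unconditionally (`exists_piChain_isoOver_transport`).
* `S.Thm_4_7_i` / `S.Thm_4_7_iii` are shape-(M) predicates on a FREE scheme-chain interface
  `S : SchemeChains E C hP hΔ hne` (the scheme side `Chain(X̃/X)` of Def 4.2 (i)(ii) is not in the
  tree, FOUNDATIONS row 12).  Over the free interface the universal closure is FALSE
  (`not_forall_thm_4_7_i`, `not_forall_thm_4_7_iii`: the empty scheme-chain datum, resp. a one-object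
  datum without terminal morphisms, over the CONCRETE extension `Π := ℤ_2 ⋊ (1 + 2ℤ_2)` (the slim
  pro-`2` group `SemiGraphs.Iw 2` of the [SemiAnbd] witness files), `G := 1`, so that `Δ = Π` is slim
  and nontrivial — `exists_slim_fundamentalExtension`), and at EVERY admissible parameter there are
  violating data (`exists_schemeChains_not_thm_4_7_i`, `exists_schemeChains_not_thm_4_7_iii`), and for
  (iii) also satisfying data (`exists_schemeChains_thm_4_7_iii`, a one-object datum; (i) asks for
  essential surjectivity onto `Chain(Π)`, whose objects form a `Type (u+1)` — not witnessed by any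
  cheap `Obj : Type u`), so the rows are MODEL-RELATIVE predicates whose content is carried entirely by
  the intended (absent) instance; the in-tree producer of `S.Thm_4_7_i` is `thm_4_7_i_of_ofMem` from
  the `𝒟`-linked named facts `Thm_4_7_i_ofMem` / `Thm_4_7_iii_ofMem` (`SemiAbsoluteChainsHyp.lean`,
  rows F-0204/F-0205, not this file's).

Also PROVED (identity morphisms of `Chain(Π)`, `Chain^{trm}(Π)`, `Chain^{iso-trm}(Π)`, Def 4.2 (iv)):
`PiChainIsoOver.refl`, `PiChain.hasTerminalHom_refl`, `PiChain.hasTerminalIso_refl`,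
`PiChain.HasTerminalIso.hasTerminalHom`; and (appended) the transport of the slimness inputs of
`PiChain` along `φ : E ≅ F` (`isSlimGroup_arith_of_iso`, `isSlimGroup_geom_of_iso`,
`geom_ne_bot_of_iso`), so that Thm 4.7 (ii) applies along every `φ` from the source's data alone
(`exists_piChain_isoOver_transport'`).

FACT-LIST reading (header rule R1, plan 05:41:23Z): F-0198 = «universal-closure REFUTED; instance
forms (refl / symm / trans / transport) PROVED»; F-0200 / F-0202 = «universal-closure REFUTED; schema
over the free scheme-chain interface, no consumed instance in the cone ((iii) model-witnessed)».  Refuted is never a fact;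
typed ≠ proved for anything not in this file; nothing here bears on [IUTchIII] Cor 3.12 or takes a
side on any author.

## References
* [MochizukiAbsTopI2012] S. Mochizuki, *Topics in absolute anabelian geometry I: generalities*,
  J. Math. Sci. Univ. Tokyo 19 (2012) 139–242 — Def 4.2 (iii)(iv) pp. 49–50, Thm 4.7 p. 57.
* [MochizukiSemiAnbd2006] S. Mochizuki, *Semi-graphs of anabelioids*, Publ. RIMS 42 (2006) — Def 2.4
  (ii) p. 25 (slimness; source of the witness group `Iw p`).
-/

noncomputable section

open CategoryTheory Topology
open scoped Pointwise

universe u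

namespace Literature.AnabelianGeometry.AbsoluteAnabelian.AbsTopI

open Literature.AlgebraicGeometry.Frobenioids (IsSlimGroup)
open FundamentalExtension

variable {E F K : FundamentalExtension.{u}}

/-! ### Identity morphisms of `Chain(Π)`, `Chain^{trm}(Π)`, `Chain^{iso-trm}(Π)` (Def 4.2 (iv)) -/

section Identities

variable {C : CuspidalData E} {hP : IsSlimGroup E.arith} {hΔ : IsSlimGroup E.geom} {hne : E.geom ≠ ⊥}

/-- Every Π-chain is isomorphic to itself in `Chain(Π)` (the identity isomorphisms of its terms).
[cite: MochizukiAbsTopI2012, Def 4.2 (iv) p.50] -/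
theorem PiChainIsoOver.refl (c : E.PiChain C hP hΔ hne) : PiChainIsoOver (Iso.refl E) c c := by
  refine ⟨rfl, fun j₁ j₂ hj => ?_, fun j₁ j₂ hj => ?_⟩
  · have : j₁ = j₂ := Fin.ext hj
    subst this
    rfl
  · have : j₁ = j₂ := Fin.ext hj
    subst this
    exact ChainGroupIsoOver.nonempty_refl _

/-- The identity of the last term is a terminal homomorphism `c → c` (identity of `Chain^{trm}(Π)`).
[cite: MochizukiAbsTopI2012, Def 4.2 (iv) p.50] -/
theorem PiChain.hasTerminalHom_refl (c : E.PiChain C hP hΔ hne) : c.HasTerminalHom c := by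
  refine ⟨ContinuousMonoidHom.id _, 1, ?_, fun x => by simp⟩
  have : Set.range (ContinuousMonoidHom.id c.last.grp) = Set.univ :=
    Set.range_eq_univ.mpr fun x => ⟨x, rfl⟩
  rw [this]
  exact isOpen_univ

/-- The identity of the last term is a terminal isomorphism `c ≅ c` (identity of `Chain^{iso-trm}(Π)`).
[cite: MochizukiAbsTopI2012, Def 4.2 (iv) p.50] -/
theorem PiChain.hasTerminalIso_refl (c : E.PiChain C hP hΔ hne) : c.HasTerminalIso c :=
  ⟨ContinuousMulEquiv.refl _, 1, fun x => by simp⟩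

/-- A terminal isomorphism is in particular a terminal homomorphism (its representative is surjective,
hence has open image). [cite: MochizukiAbsTopI2012, Def 4.2 (iv) p.50] -/
theorem PiChain.HasTerminalIso.hasTerminalHom {c c' : E.PiChain C hP hΔ hne} (h : c.HasTerminalIso c') :
    c.HasTerminalHom c' := by
  obtain ⟨φ, g, hφ⟩ := h
  refine ⟨⟨φ.toMonoidHom, φ.continuous⟩, g, ?_, fun x => hφ x⟩
  have : Set.range (⟨φ.toMonoidHom, φ.continuous⟩ : c.last.grp →ₜ* c'.last.grp) = Set.univ :=
    Set.range_eq_univ.mpr fun y => ⟨φ.symm y, φ.apply_symm_apply y⟩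
  rw [this]
  exact isOpen_univ

end Identities

/-! ### F-0198: the instance forms of `CuspidalDataCompat` — reflexivity, transitivity, transport -/

/-- **F-0198, instance form (reflexivity):** cuspidal data correspond to themselves under the identity
(`σ := id`, conjugator `1`) — the case `φ = id` of Thm 4.7 (ii), i.e. the category `Chain(Π)` itself.
[cite: MochizukiAbsTopI2012, Def 4.2 (iii) p.49] -/
theorem CuspidalDataCompat.refl (C : CuspidalData E) : CuspidalDataCompat (Iso.refl E) C C := by
  refine ⟨Equiv.refl _, fun x => ⟨1, ?_⟩⟩
  rw [map_one, one_smul]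
  ext y
  refine ⟨fun hy => ⟨y, hy, rfl⟩, ?_⟩
  rintro ⟨z, hz, rfl⟩
  exact hz

/-- **F-0198, instance form (transitivity):** correspondences of cuspidal data compose along
`φ ≪≫ ψ` (compose the bijections of cusps; the conjugators compose as `g' · ψ(g)`).
[cite: MochizukiAbsTopI2012, Def 4.2 (iii) p.49] -/
theorem CuspidalDataCompat.trans {φ : E ≅ F} {ψ : F ≅ K} {C₁ : CuspidalData E} {C₂ : CuspidalData F}
    {C₃ : CuspidalData K} (h : CuspidalDataCompat φ C₁ C₂) (h' : CuspidalDataCompat ψ C₂ C₃) :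
    CuspidalDataCompat (φ ≪≫ ψ) C₁ C₃ := by
  obtain ⟨σ, hσ⟩ := h
  obtain ⟨τ, hτ⟩ := h'
  refine ⟨σ.trans τ, fun x => ?_⟩
  obtain ⟨g, hg⟩ := hσ x
  obtain ⟨g', hg'⟩ := hτ (σ x)
  refine ⟨g' * ψ.hom.arith g, ?_⟩
  rw [Equiv.trans_apply, hg', hg, map_conj_smul, Subgroup.map_map, map_mul, mul_smul]
  rfl

/-- The image of a closed subgroup of `Π_E` under an isomorphism of extensions is closed in `Π_F`
(it is the preimage under `φ⁻¹`). [cite: MochizukiAbsTopI2012, Def 4.2 (iv) p.50] -/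
theorem isClosed_map_arith_of_iso (φ : E ≅ F) {D : Subgroup E.arith} (hD : IsClosed (D : Set E.arith)) :
    IsClosed ((D.map φ.hom.arith.toMonoidHom : Subgroup F.arith) : Set F.arith) := by
  have hset : ((D.map φ.hom.arith.toMonoidHom : Subgroup F.arith) : Set F.arith) =
      φ.inv.arith ⁻¹' (D : Set E.arith) := by
    ext y
    simp only [Subgroup.coe_map, Set.mem_image, SetLike.mem_coe, Set.mem_preimage]
    constructor
    · rintro ⟨x, hx, rfl⟩
      change φ.inv.arith (φ.hom.arith x) ∈ D
      rwa [iso_inv_hom_arith]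
    · intro hy
      exact ⟨φ.inv.arith y, hy, iso_hom_inv_arith φ y⟩
  rw [hset]
  exact hD.preimage φ.inv.arith.continuous

/-- `φ⁻¹(φ(D)) = D` for subgroups under an isomorphism of extensions.
[cite: MochizukiAbsTopI2012, Def 4.2 (iv) p.50] -/
theorem map_inv_map_hom_arith (φ : E ≅ F) (D : Subgroup E.arith) :
    (D.map φ.hom.arith.toMonoidHom).map φ.inv.arith.toMonoidHom = D := by
  rw [Subgroup.map_map]
  have hid : φ.inv.arith.toMonoidHom.comp φ.hom.arith.toMonoidHom = MonoidHom.id _ :=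
    MonoidHom.ext (iso_inv_hom_arith φ)
  rw [hid, Subgroup.map_id]

/-- **F-0198, instance form (transport):** along every isomorphism of extensions `φ : E ≅ F`, every
cuspidal datum `C₁` on `Π_E` corresponds to SOME cuspidal datum on `Π_F` — namely `φ(C₁)`: the same
cusps with decomposition groups `φ(D_x)` (closed; pairwise non-conjugate because `φ⁻¹` transports a
conjugacy back).  This is the form in which the hypothesis of Thm 4.7 (ii) is discharged ("cuspidal
decomposition groups are given up to conjugacy", Def 4.2 (iii) (3_Π); Lemma 4.5 (v)).
[cite: MochizukiAbsTopI2012, Def 4.2 (iii) p.49] -/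
theorem exists_cuspidalDataCompat (φ : E ≅ F) (C₁ : CuspidalData E) :
    ∃ C₂ : CuspidalData F, CuspidalDataCompat φ C₁ C₂ := by
  haveI := C₁.finite
  refine ⟨{ Cusp := C₁.Cusp
            Dcusp := fun x => (C₁.Dcusp x).map φ.hom.arith.toMonoidHom
            Icusp := fun x => (C₁.Dcusp x).map φ.hom.arith.toMonoidHom ⊓ F.geom
            Icusp_eq := fun _ => rfl
            isClosed_Dcusp := fun x => isClosed_map_arith_of_iso φ (C₁.isClosed_Dcusp x)
            eq_of_conj := fun x y g hxy => ?_ }, Equiv.refl _, fun x => ⟨1, ?_⟩⟩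
  · apply C₁.eq_of_conj x y (φ.inv.arith g)
    have h := congrArg (Subgroup.map φ.inv.arith.toMonoidHom) hxy
    rw [map_conj_smul, map_inv_map_hom_arith, map_inv_map_hom_arith] at h
    exact h
  · rw [map_one, one_smul]
    rfl

/-- Hence Thm 4.7 (ii) (`thm_4_7_ii_holds`) applies along EVERY isomorphism of extensions: each
`Π_E`-chain (for cuspidal data `C₁`) is `φ`-isomorphic to a `Π_F`-chain for the transported cuspidal
data. [cite: MochizukiAbsTopI2012, Thm 4.7 (ii) p.57] -/
theorem exists_piChain_isoOver_transport (φ : E ≅ F) (C₁ : CuspidalData E)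
    (hP₁ : IsSlimGroup E.arith) (hΔ₁ : IsSlimGroup E.geom) (hne₁ : E.geom ≠ ⊥)
    (hP₂ : IsSlimGroup F.arith) (hΔ₂ : IsSlimGroup F.geom) (hne₂ : F.geom ≠ ⊥) :
    ∃ C₂ : CuspidalData F, CuspidalDataCompat φ C₁ C₂ ∧
      ∀ c₁ : E.PiChain C₁ hP₁ hΔ₁ hne₁, ∃ c₂ : F.PiChain C₂ hP₂ hΔ₂ hne₂, PiChainIsoOver φ c₁ c₂ := by
  obtain ⟨C₂, hC⟩ := exists_cuspidalDataCompat φ C₁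
  exact ⟨C₂, hC, fun c₁ => exists_isoOver φ C₂ hP₂ hΔ₂ hne₂ hC c₁⟩

/-! ### F-0198: the universal closure is false (at every extension) -/

/-- **F-0198, universal closure false at every extension:** the cuspidal datum with NO cusps and the
one with ONE cusp whose decomposition group is `Π` do not correspond under the identity (no bijection
`∅ ≃ {⋆}`). [cite: MochizukiAbsTopI2012, Def 4.2 (iii) p.49] -/
theorem exists_not_cuspidalDataCompat (E : FundamentalExtension.{u}) :
    ∃ C₁ C₂ : CuspidalData E, ¬ CuspidalDataCompat (Iso.refl E) C₁ C₂ := by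
  refine ⟨{ Cusp := PEmpty
            Dcusp := fun x => x.elim
            Icusp := fun x => x.elim
            Icusp_eq := fun x => x.elim
            isClosed_Dcusp := fun x => x.elim
            eq_of_conj := fun x => x.elim },
          { Cusp := PUnit
            Dcusp := fun _ => ⊤
            Icusp := fun _ => ⊤ ⊓ E.geom
            Icusp_eq := fun _ => rfl
            isClosed_Dcusp := fun _ => by
              rw [Subgroup.coe_top]
              exact isClosed_univ
            eq_of_conj := fun _ _ _ _ => Subsingleton.elim _ _ }, ?_⟩
  rintro ⟨σ, -⟩
  exact (σ.symm PUnit.unit).elim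

/-! ### A concrete extension with `Π` slim and `Δ = Π` slim and nontrivial -/

/-- **A concrete admissible parameter:** the extension `1 → Δ → Π → G → 1` with
`Π := ℤ_2 ⋊ (1 + 2ℤ_2)` (the slim pro-`2` group `SemiGraphs.Iw 2`, slimness kernel-checked in
`SemiGraphs.Iw.centralizer_eq_bot_of_isOpen`), `G := 1`, hence `Δ = Π`: `Π` is slim, `Δ` is slim,
`Δ ≠ 1` — so the slimness inputs of `PiChain` / `SchemeChains` are jointly satisfiable and the schema
rows below have NON-VACUOUS parameter spaces. [cite: MochizukiSemiAnbd2006, Def 2.4(ii) p.25] -/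
theorem exists_slim_fundamentalExtension :
    ∃ E : FundamentalExtension.{0}, IsSlimGroup E.arith ∧ IsSlimGroup E.geom ∧ E.geom ≠ ⊥ := by
  let P : ProfiniteGrp.{0} := ProfiniteGrp.of (SemiGraphs.Iw 2)
  let G : ProfiniteGrp.{0} := ProfiniteGrp.of PUnit.{1}
  let aug : P →ₜ* G := { toMonoidHom := 1, continuous_toFun := continuous_const }
  let E : FundamentalExtension.{0} :=
    { arith := P, gal := G, aug := aug, aug_surjective := fun g => ⟨1, Subsingleton.elim _ _⟩ }
  have hslim : IsSlimGroup E.arith := ⟨SemiGraphs.Iw.centralizer_eq_bot_of_isOpen⟩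
  have hker : E.geom = ⊤ := by
    ext g
    simp only [FundamentalExtension.mem_geom, Subgroup.mem_top, iff_true]
    exact Subsingleton.elim _ _
  let eTop : (⊤ : Subgroup E.arith) ≃ₜ* E.arith :=
    { Subgroup.topEquiv with
      continuous_toFun := continuous_subtype_val
      continuous_invFun := by
        change Continuous fun g : E.arith => (⟨g, Subgroup.mem_top g⟩ : (⊤ : Subgroup E.arith))
        exact continuous_id.subtype_mk _ }
  refine ⟨E, hslim, ?_, ?_⟩
  · rw [hker]
    exact (isSlimGroup_congr eTop).mpr hslim
  · rw [hker]
    intro h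
    have hx : (⟨1, 0⟩ : SemiGraphs.Iw 2) ∈ (⊥ : Subgroup E.arith) := h ▸ Subgroup.mem_top _
    rw [Subgroup.mem_bot] at hx
    have ha := congrArg SemiGraphs.Iw.a hx
    simp only [SemiGraphs.Iw.one_a] at ha
    exact one_ne_zero ha

/-- **F-0198, universal closure refuted** (the fully quantified closure of the row, at universe `0`).
[cite: MochizukiAbsTopI2012, Def 4.2 (iii) p.49] -/
theorem not_forall_cuspidalDataCompat :
    ¬ ∀ (E F : FundamentalExtension.{0}) (φ : E ≅ F) (C₁ : CuspidalData E) (C₂ : CuspidalData F),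
        CuspidalDataCompat φ C₁ C₂ := by
  intro h
  obtain ⟨E, -, -, -⟩ := exists_slim_fundamentalExtension
  obtain ⟨C₁, C₂, hC⟩ := exists_not_cuspidalDataCompat E
  exact hC (h E E (Iso.refl E) C₁ C₂)

/-! ### F-0200 / F-0202: model witness and violating models at every parameter; closures refuted -/

section SchemeChainsModels

variable (C : CuspidalData E) (hP : IsSlimGroup E.arith) (hΔ : IsSlimGroup E.geom) (hne : E.geom ≠ ⊥)

/-- **F-0202, model witness at every parameter:** the ONE-OBJECT scheme-chain datum sent to the
trivial chain `Π` (length `0`), with all (terminal) (iso)morphism predicates `True`, satisfies Thm 4.7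
(iii) as typed (fullness on terminal homomorphisms) — so that schema row is consistent at every
admissible `(E, C, hP, hΔ, hne)`.  (Thm 4.7 (i) is NOT model-witnessed here: a witness must be
essentially surjective onto `Chain(Π)`, whose objects `E.PiChain …` form a `Type (u+1)` ranging over
all profinite groups of the universe, while `SchemeChains.Obj : Type u`; the intended witness of both
rows is the scheme-theoretic instance, absent from the tree — FOUNDATIONS row 12.)
[cite: MochizukiAbsTopI2012, Thm 4.7 (iii) p.57] -/
theorem exists_schemeChains_thm_4_7_iii :
    ∃ S : SchemeChains E C hP hΔ hne, S.Thm_4_7_iii := by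
  let c₀ : E.PiChain C hP hΔ hne :=
    { len := 0
      term := fun _ => ChainGroup.self hP hΔ hne
      term_zero := rfl
      types := fun j => j.elim0
      isElemOp := fun j => j.elim0 }
  exact ⟨{ Obj := PUnit
           toPiChain := fun _ => c₀
           ChainIso := fun _ _ => True
           HasTerminalMor := fun _ _ => True
           HasTerminalIso := fun _ _ => True
           map_iso := fun _ _ _ => PiChainIsoOver.refl c₀
           map_terminalMor := fun _ _ _ => PiChain.hasTerminalHom_refl c₀
           map_terminalIso := fun _ _ _ => PiChain.hasTerminalIso_refl c₀ }, fun _ _ _ => trivial⟩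

/-- **F-0200, violating model at every parameter:** the EMPTY scheme-chain datum is not essentially
surjective onto `Chain(Π)` (which contains the trivial chain `Π` of length `0`), so it fails
Thm 4.7 (i) as typed. [cite: MochizukiAbsTopI2012, Thm 4.7 (i) p.57] -/
theorem exists_schemeChains_not_thm_4_7_i :
    ∃ S : SchemeChains E C hP hΔ hne, ¬ S.Thm_4_7_i := by
  refine ⟨{ Obj := PEmpty
            toPiChain := fun x => x.elim
            ChainIso := fun x _ => x.elim
            HasTerminalMor := fun x _ => x.elim
            HasTerminalIso := fun x _ => x.elim
            map_iso := fun x _ _ => x.elim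
            map_terminalMor := fun x _ _ => x.elim
            map_terminalIso := fun x _ _ => x.elim }, ?_⟩
  rintro ⟨h, -, -⟩
  obtain ⟨x, -⟩ := h
    { len := 0
      term := fun _ => ChainGroup.self hP hΔ hne
      term_zero := rfl
      types := fun j => j.elim0
      isElemOp := fun j => j.elim0 }
  exact x.elim

/-- **F-0202, violating model at every parameter:** the one-object scheme-chain datum sent to the
trivial chain `Π`, with NO terminal morphisms, is not full on terminal homomorphisms (the identity
`Π → Π` is one), so it fails Thm 4.7 (iii) as typed. [cite: MochizukiAbsTopI2012, Thm 4.7 (iii) p.57] -/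
theorem exists_schemeChains_not_thm_4_7_iii :
    ∃ S : SchemeChains E C hP hΔ hne, ¬ S.Thm_4_7_iii := by
  let c₀ : E.PiChain C hP hΔ hne :=
    { len := 0
      term := fun _ => ChainGroup.self hP hΔ hne
      term_zero := rfl
      types := fun j => j.elim0
      isElemOp := fun j => j.elim0 }
  refine ⟨{ Obj := PUnit
            toPiChain := fun _ => c₀
            ChainIso := fun _ _ => True
            HasTerminalMor := fun _ _ => False
            HasTerminalIso := fun _ _ => True
            map_iso := fun _ _ _ => PiChainIsoOver.refl c₀
            map_terminalMor := fun _ _ h => h.elim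
            map_terminalIso := fun _ _ _ => PiChain.hasTerminalIso_refl c₀ }, ?_⟩
  intro h
  exact h PUnit.unit PUnit.unit (PiChain.hasTerminalHom_refl c₀)

end SchemeChainsModels

/-- **F-0200, universal closure refuted** (the fully quantified closure of the row, at universe `0`,
over the concrete extension of `exists_slim_fundamentalExtension` with empty cuspidal data).
[cite: MochizukiAbsTopI2012, Thm 4.7 (i) p.57] -/
theorem not_forall_thm_4_7_i :
    ¬ ∀ (E : FundamentalExtension.{0}) (C : CuspidalData E) (hP : IsSlimGroup E.arith)
        (hΔ : IsSlimGroup E.geom) (hne : E.geom ≠ ⊥) (S : SchemeChains E C hP hΔ hne), S.Thm_4_7_i := by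
  intro h
  obtain ⟨E, hP, hΔ, hne⟩ := exists_slim_fundamentalExtension
  obtain ⟨C, -, -⟩ := exists_not_cuspidalDataCompat E
  obtain ⟨S, hS⟩ := exists_schemeChains_not_thm_4_7_i C hP hΔ hne
  exact hS (h E C hP hΔ hne S)

/-- **F-0202, universal closure refuted** (the fully quantified closure of the row, at universe `0`).
[cite: MochizukiAbsTopI2012, Thm 4.7 (iii) p.57] -/
theorem not_forall_thm_4_7_iii :
    ¬ ∀ (E : FundamentalExtension.{0}) (C : CuspidalData E) (hP : IsSlimGroup E.arith)
        (hΔ : IsSlimGroup E.geom) (hne : E.geom ≠ ⊥) (S : SchemeChains E C hP hΔ hne), S.Thm_4_7_iii := by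
  intro h
  obtain ⟨E, hP, hΔ, hne⟩ := exists_slim_fundamentalExtension
  obtain ⟨C, -, -⟩ := exists_not_cuspidalDataCompat E
  obtain ⟨S, hS⟩ := exists_schemeChains_not_thm_4_7_iii C hP hΔ hne
  exact hS (h E C hP hΔ hne S)

/-! ### The slimness inputs of `PiChain` transport along an isomorphism of extensions

Appended (abc-iut-f-058, same session): with these, Thm 4.7 (ii) (`thm_4_7_ii_holds`) applies along
every `φ : E ≅ F` given only the SOURCE's inputs `Π_E` slim, `Δ_E` slim, `Δ_E ≠ 1` and cuspidal data
`C₁` (`exists_piChain_isoOver_transport'`). -/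

/-- `φ : E ≅ F` restricts to an isomorphism of topological groups `Δ_E ≃ Δ_F` ("an isomorphism of
profinite groups that induces isomorphisms `φ_Δ : Δ₁ ≅ Δ₂`", Thm 4.7 p. 56).
[cite: MochizukiAbsTopI2012, Thm 4.7 p.56] -/
theorem nonempty_geom_continuousMulEquiv (φ : E ≅ F) : Nonempty (E.geom ≃ₜ* F.geom) :=
  ⟨{ toFun := fun x => ⟨φ.hom.arith (x : E.arith), φ.hom.mapsTo_geom x.2⟩
     invFun := fun y => ⟨φ.inv.arith (y : F.arith), φ.inv.mapsTo_geom y.2⟩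
     left_inv := fun x => Subtype.ext (iso_inv_hom_arith φ (x : E.arith))
     right_inv := fun y => Subtype.ext (iso_hom_inv_arith φ (y : F.arith))
     map_mul' := fun x y => Subtype.ext (map_mul φ.hom.arith (x : E.arith) (y : E.arith))
     continuous_toFun := (φ.hom.arith.continuous.comp continuous_subtype_val).subtype_mk _
     continuous_invFun := (φ.inv.arith.continuous.comp continuous_subtype_val).subtype_mk _ }⟩

/-- `Π_F` is slim if `Π_E` is, for `φ : E ≅ F`. [cite: MochizukiAbsTopI2012, Thm 4.7 p.56] -/
theorem isSlimGroup_arith_of_iso (φ : E ≅ F) (h : IsSlimGroup E.arith) : IsSlimGroup F.arith :=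
  isSlimGroup_of_continuousMulEquiv (isoArith φ) h

/-- `Δ_F` is slim if `Δ_E` is, for `φ : E ≅ F`. [cite: MochizukiAbsTopI2012, Thm 4.7 p.56] -/
theorem isSlimGroup_geom_of_iso (φ : E ≅ F) (h : IsSlimGroup E.geom) : IsSlimGroup F.geom := by
  obtain ⟨e⟩ := nonempty_geom_continuousMulEquiv φ
  exact isSlimGroup_of_continuousMulEquiv e h

/-- `Δ_F ≠ 1` if `Δ_E ≠ 1`, for `φ : E ≅ F`. [cite: MochizukiAbsTopI2012, Thm 4.7 p.56] -/
theorem geom_ne_bot_of_iso (φ : E ≅ F) (h : E.geom ≠ ⊥) : F.geom ≠ ⊥ := by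
  intro hF
  apply h
  rw [eq_bot_iff]
  intro x hx
  have hx' : φ.hom.arith x ∈ F.geom := φ.hom.mapsTo_geom hx
  rw [hF, Subgroup.mem_bot] at hx'
  rw [Subgroup.mem_bot, ← iso_inv_hom_arith φ x, hx', map_one]

/-- **Thm 4.7 (ii) along every isomorphism of extensions, from the source's data alone:** for
`φ : E ≅ F`, cuspidal data `C₁` on `Π_E` and the slimness inputs of `Π_E`-chains, the target carries
the transported inputs and cuspidal data `C₂ = φ(C₁)`, and every `Π_E`-chain is `φ`-isomorphic to a
`Π_F`-chain (`thm_4_7_ii_holds` / `exists_isoOver` with `exists_cuspidalDataCompat`).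
[cite: MochizukiAbsTopI2012, Thm 4.7 (ii) p.57] -/
theorem exists_piChain_isoOver_transport' (φ : E ≅ F) (C₁ : CuspidalData E)
    (hP₁ : IsSlimGroup E.arith) (hΔ₁ : IsSlimGroup E.geom) (hne₁ : E.geom ≠ ⊥) :
    ∃ (C₂ : CuspidalData F) (hP₂ : IsSlimGroup F.arith) (hΔ₂ : IsSlimGroup F.geom)
      (hne₂ : F.geom ≠ ⊥), CuspidalDataCompat φ C₁ C₂ ∧
      ∀ c₁ : E.PiChain C₁ hP₁ hΔ₁ hne₁, ∃ c₂ : F.PiChain C₂ hP₂ hΔ₂ hne₂, PiChainIsoOver φ c₁ c₂ := by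
  obtain ⟨C₂, hC, h⟩ := exists_piChain_isoOver_transport φ C₁ hP₁ hΔ₁ hne₁
    (isSlimGroup_arith_of_iso φ hP₁) (isSlimGroup_geom_of_iso φ hΔ₁) (geom_ne_bot_of_iso φ hne₁)
  exact ⟨C₂, _, _, _, hC, h⟩

end Literature.AnabelianGeometry.AbsoluteAnabelian.AbsTopI
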